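import Summits.QuantumFields.YangMills.Theorems.UnitScaleTiltProp8ChartDefs
import HarnessLib

/-!
# Route `UnitScaleTilt`, crux K1 «MinimiserStabilityRegPr» (stmt-QuantumFields-19200), leaf V2′ `stub_halvingStep` — pillar P3 `ChartPerLevel`:
# **THE MULTI-LEVEL (0.4)-CONSTRAINT MAP IN THE CHART IS ℂ-DIFFERENTIABLE AT THE FLAT POINT** (the qualitative core of `ChartRemainderAt`'s hCd, and what makes
# its `fderiv ℂ (chartLog η D) 0` — the TRUE linearised constraint of the hCq/hH letters — an honest derivative)

Cell `ym3-torus` ∕ fleet seat `ym-ust-19200-p2` g5 (v8 PEN).  `Prop8Chart.chartLog η D A = (−i)·log((emlIterU j (e^{iηA}))(c))` at every index `(j, c)`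
(`Prop8ChartDefs`); the P3 text `ChartRemainderAt` (p539223) is written with `fderiv ℂ (chartLog η D) 0`.  This file proves, for EVERY complete normed
`ℂ`-algebra `𝔸`, every `Params`, every nested family `D` and every `η`:
* `differentiableAt_coe_holT` — the torus transport along any word of a field depending ℂ-differentiably (bondwise, in `𝔸`) on a parameter is
  ℂ-differentiable in the parameter (products and `Ring.inverse` at units);
* `differentiableAt_coe_emlAvgU` — so is the UNGUARDED (0.4) average at a parameter value where every loop variable is within `1` of `1`
  (`ExpMeanLog.differentiableAt_eml`);
* `differentiableAt_coe_emlIterU_expCfg_zero` — every iterated average of `e^{iηA}` is ℂ-differentiable in `A` at `A = 0` (induction; at the flat point all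
  loop variables are `1`);
* **`differentiableAt_chartLog_zero : DifferentiableAt ℂ (chartLog η D) 0`** and `differentiableAt_chartQ_zero` (`MatrixLog.analyticAt_mlog` at `1`).
Sorry-free, definition-free; no estimate (the quantitative radius `R` and the k-uniform remainder are P3's content).  NOT a claim about the mass gap.

References: T. Bałaban, CMP **109** (1987) 249–301 [Balaban1987RG1] (p.253 «It is a Gᶜ-valued function … we assume that it is an analytic function»);
CMP **102** (1985) 277–309 [Balaban1985Variational] ((47)–(48) p.287, (156) p.302).
-/

noncomputable section

open scoped BigOperators
open NormedSpace

namespace Summit.QuantumFields.YangMills.Theorems.Prop8Chart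

open Literature.MathematicalPhysics.QuantumFieldTheory.Balaban1983to89
open T4Continuum BlockAveraging ExpMeanLog MatrixLog
open B10Eq27TorusAxialLog (holT holT_nil holT_cons_true holT_cons_false)
open B6SectADomainsV1 (Domains)
open B6SectAOperatorsV1 (BondIdx)

variable {P : Params} {𝔸 : Type*} [NormedRing 𝔸] [NormedAlgebra ℂ 𝔸] [CompleteSpace 𝔸]
variable {E : Type*} [NormedAddCommGroup E] [NormedSpace ℂ E]

/-! ## §1 Transports of differentiable families are differentiable -/

/-- The inverse of a unit-valued differentiable family, read in `𝔸`, is differentiable (`Ring.inverse` at a unit). [folklore] -/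
theorem differentiableAt_coe_inv {g : E → 𝔸ˣ} {x₀ : E} (hg : DifferentiableAt ℂ (fun x => ((g x : 𝔸ˣ) : 𝔸)) x₀) :
    DifferentiableAt ℂ (fun x => (((g x)⁻¹ : 𝔸ˣ) : 𝔸)) x₀ := by
  have h : (fun x => (((g x)⁻¹ : 𝔸ˣ) : 𝔸)) = Ring.inverse ∘ fun x => ((g x : 𝔸ˣ) : 𝔸) := by
    funext x; simp
  rw [h]
  have hi : DifferentiableAt ℂ (Ring.inverse : 𝔸 → 𝔸) ((g x₀ : 𝔸ˣ) : 𝔸) := differentiableAt_inverse (g x₀).isUnit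
  exact hi.comp x₀ hg

/-- **THE TORUS TRANSPORT OF A DIFFERENTIABLE FAMILY IS DIFFERENTIABLE**: if every bond variable of `F x : GaugeField P j 𝔸ˣ` depends ℂ-differentiably on
`x` at `x₀` (read in `𝔸`), then so does `holT (F x) y w` for every base site and word (finite products of bond variables and their inverses).
[cite: Balaban1985Averaging, (9) p.18] -/
theorem differentiableAt_coe_holT {j : ℕ} {F : E → GaugeField P j 𝔸ˣ} {x₀ : E}
    (hF : ∀ b : PBond P j, DifferentiableAt ℂ (fun x => ((F x b : 𝔸ˣ) : 𝔸)) x₀) :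
    ∀ (w : List (Letter P.d)) (y : Site P j), DifferentiableAt ℂ (fun x => ((holT (F x) y w : 𝔸ˣ) : 𝔸)) x₀
  | [], y => by simp [holT_nil]
  | (μ, true) :: w, y => by
    have ih := differentiableAt_coe_holT hF w (y.shift μ)
    have h : (fun x => ((holT (F x) y ((μ, true) :: w) : 𝔸ˣ) : 𝔸)) =
        fun x => ((F x ⟨y, μ⟩ : 𝔸ˣ) : 𝔸) * ((holT (F x) (y.shift μ) w : 𝔸ˣ) : 𝔸) := by
      funext x; rw [holT_cons_true, Units.val_mul]
    rw [h]
    exact (hF _).mul ih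
  | (μ, false) :: w, y => by
    have ih := differentiableAt_coe_holT hF w (y.unshift μ)
    have h : (fun x => ((holT (F x) y ((μ, false) :: w) : 𝔸ˣ) : 𝔸)) =
        fun x => (((F x ⟨y.unshift μ, μ⟩)⁻¹ : 𝔸ˣ) : 𝔸) * ((holT (F x) (y.unshift μ) w : 𝔸ˣ) : 𝔸) := by
      funext x; rw [holT_cons_false, Units.val_mul]
    rw [h]
    exact (differentiableAt_coe_inv (hF _)).mul ih

/-! ## §2 The unguarded (0.4) average of a differentiable family -/

/-- **THE UNGUARDED (0.4) AVERAGE IS DIFFERENTIABLE** at a parameter value where every loop variable at `c` is within `1` of `1` (the analyticity domain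
of `exp[mean log]`). [cite: Balaban1987RG1, (0.4) p.253] -/
theorem differentiableAt_coe_emlAvgU {j : ℕ} {F : E → GaugeField P j 𝔸ˣ} {x₀ : E}
    (hF : ∀ b : PBond P j, DifferentiableAt ℂ (fun x => ((F x b : 𝔸ˣ) : 𝔸)) x₀) (c : PBond P (j + 1))
    (hloop : ∀ i : Idx P, ‖((loopHolU (F x₀) c i : 𝔸ˣ) : 𝔸) - 1‖ < 1) :
    DifferentiableAt ℂ (fun x => ((emlAvgU (F x) c : 𝔸ˣ) : 𝔸)) x₀ := by
  have h : (fun x => ((emlAvgU (F x) c : 𝔸ˣ) : 𝔸)) = fun x =>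
      eml (fun i : Idx P => ((loopHolU (F x) c i : 𝔸ˣ) : 𝔸)) * ((holT (F x) (emb c.src) (List.replicate P.L (c.dir, true)) : 𝔸ˣ) : 𝔸) := by
    funext x; exact coe_emlAvgU (F x) c
  rw [h]
  refine DifferentiableAt.mul ?_ (differentiableAt_coe_holT hF _ _)
  have hfam : DifferentiableAt ℂ (fun x => fun i : Idx P => ((loopHolU (F x) c i : 𝔸ˣ) : 𝔸)) x₀ :=
    differentiableAt_pi.mpr fun i => by unfold loopHolU; exact differentiableAt_coe_holT hF _ _
  exact (differentiableAt_eml hloop).comp x₀ hfam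

/-! ## §3 The iterated averages of `e^{iηA}` at `A = 0` -/

/-- The charted bond variable `e^{iηA(b)}` is ℂ-differentiable in `A` (everywhere). [cite: Balaban1985Variational, (152) p.301] -/
theorem differentiableAt_coe_expCfg (η : ℝ) (b : PBond P 0) (A₀ : PBond P 0 → 𝔸) :
    DifferentiableAt ℂ (fun A : PBond P 0 → 𝔸 => ((expCfg η A b : 𝔸ˣ) : 𝔸)) A₀ := by
  have h : (fun A : PBond P 0 → 𝔸 => ((expCfg η A b : 𝔸ˣ) : 𝔸)) = fun A => exp ((Complex.I * (η : ℂ)) • A b) := by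
    funext A; exact coe_expCfg η A b
  rw [h]
  have hproj : DifferentiableAt ℂ (fun A : PBond P 0 → 𝔸 => A b) A₀ :=
    (ContinuousLinearMap.proj (R := ℂ) (φ := fun _ : PBond P 0 => 𝔸) b).differentiableAt
  have hsm : DifferentiableAt ℂ (fun A : PBond P 0 → 𝔸 => (Complex.I * (η : ℂ)) • A b) A₀ := hproj.const_smul (Complex.I * (η : ℂ))
  exact (exp_analytic _).differentiableAt.comp A₀ hsm

/-- **EVERY ITERATED UNGUARDED AVERAGE OF `e^{iηA}` IS ℂ-DIFFERENTIABLE IN `A` AT THE FLAT POINT** (induction on the level: at `A = 0` every iterate is the flat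
field, so every loop variable is `1` and §2 applies). [cite: Balaban1987RG1, (0.4) and (0.11) p.253] -/
theorem differentiableAt_coe_emlIterU_expCfg_zero (η : ℝ) :
    ∀ (i : ℕ) (b : PBond P i), DifferentiableAt ℂ (fun A : PBond P 0 → 𝔸 => ((emlIterU i (expCfg η A) b : 𝔸ˣ) : 𝔸)) 0
  | 0, b => by simpa only [emlIterU_zero] using differentiableAt_coe_expCfg (P := P) (𝔸 := 𝔸) η b 0
  | i + 1, c => by
    have hF : ∀ b : PBond P i, DifferentiableAt ℂ (fun A : PBond P 0 → 𝔸 => ((emlIterU i (expCfg η A) b : 𝔸ˣ) : 𝔸)) 0 :=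
      fun b => differentiableAt_coe_emlIterU_expCfg_zero η i b
    have h : (fun A : PBond P 0 → 𝔸 => ((emlIterU (i + 1) (expCfg η A) c : 𝔸ˣ) : 𝔸)) =
        fun A => ((emlAvgU (emlIterU i (expCfg η A)) c : 𝔸ˣ) : 𝔸) := by
      funext A; rw [emlIterU_succ]
    rw [h]
    refine differentiableAt_coe_emlAvgU (F := fun A : PBond P 0 → 𝔸 => emlIterU i (expCfg η A)) hF c fun idx => ?_
    -- at the flat point every loop variable is `1`
    have hflat : emlIterU i (expCfg η (0 : PBond P 0 → 𝔸)) = fun _ => 1 := by rw [expCfg_zero, emlIterU_one]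
    rw [hflat, loopHolU, B10Eq27TorusAxialLog.holT_one, Units.val_one, sub_self, norm_zero]
    exact one_pos

/-! ## §4 `chartLog` and `chartQ` are differentiable at the origin -/

/-- **`𝒬` (print's reading) IS ℂ-DIFFERENTIABLE AT THE FLAT POINT**: `DifferentiableAt ℂ (chartLog η D) 0` — so `fderiv ℂ (chartLog η D) 0`, the linearised
multi-level (0.4)-constraint of the P3 text `ChartRemainderAt`, is an honest Fréchet derivative. [cite: Balaban1985Variational, (47)-(48) p.287, (156) p.302] -/
theorem differentiableAt_chartLog_zero (η : ℝ) (D : Domains P) :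
    DifferentiableAt ℂ (chartLog η D : (PBond P 0 → 𝔸) → BondIdx D → 𝔸) 0 := by
  refine differentiableAt_pi.mpr fun i => ?_
  have hval : ((emlIterU (i.1.1 : ℕ) (expCfg η (0 : PBond P 0 → 𝔸)) i.1.2 : 𝔸ˣ) : 𝔸) = 1 := by
    rw [expCfg_zero, emlIterU_one, Units.val_one]
  have hlog : DifferentiableAt ℂ (mlog : 𝔸 → 𝔸) (((emlIterU (i.1.1 : ℕ) (expCfg η (0 : PBond P 0 → 𝔸)) i.1.2 : 𝔸ˣ) : 𝔸)) := by
    rw [hval]; exact (MatrixLog.analyticAt_mlog (by rw [sub_self, norm_zero]; exact one_pos)).differentiableAt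
  have hfun : (fun A : PBond P 0 → 𝔸 => chartLog η D A i) =
      fun A => (-Complex.I) • mlog (((emlIterU (i.1.1 : ℕ) (expCfg η A)) i.1.2 : 𝔸ˣ) : 𝔸) := rfl
  rw [hfun]
  exact (hlog.comp 0 (differentiableAt_coe_emlIterU_expCfg_zero (P := P) (𝔸 := 𝔸) η i.1.1 i.1.2)).const_smul (-Complex.I)

/-- The same for the tree-normalised reading `chartQ`. [cite: Balaban1985Variational, (156) p.302] -/
theorem differentiableAt_chartQ_zero (η : ℝ) (D : Domains P) :
    DifferentiableAt ℂ (chartQ η D : (PBond P 0 → 𝔸) → BondIdx D → 𝔸) 0 := by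
  refine differentiableAt_pi.mpr fun i => ?_
  have hval : ((emlIterU (i.1.1 : ℕ) (expCfg η (0 : PBond P 0 → 𝔸)) i.1.2 : 𝔸ˣ) : 𝔸) = 1 := by
    rw [expCfg_zero, emlIterU_one, Units.val_one]
  have hlog : DifferentiableAt ℂ (mlog : 𝔸 → 𝔸) (((emlIterU (i.1.1 : ℕ) (expCfg η (0 : PBond P 0 → 𝔸)) i.1.2 : 𝔸ˣ) : 𝔸)) := by
    rw [hval]; exact (MatrixLog.analyticAt_mlog (by rw [sub_self, norm_zero]; exact one_pos)).differentiableAt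
  have hfun : (fun A : PBond P 0 → 𝔸 => chartQ η D A i) =
      fun A => ((Complex.I * (η : ℂ) * ((P.L : ℂ) ^ (i.1.1 : ℕ)))⁻¹) • mlog (((emlIterU (i.1.1 : ℕ) (expCfg η A)) i.1.2 : 𝔸ˣ) : 𝔸) := rfl
  rw [hfun]
  exact (hlog.comp 0 (differentiableAt_coe_emlIterU_expCfg_zero (P := P) (𝔸 := 𝔸) η i.1.1 i.1.2)).const_smul
    ((Complex.I * (η : ℂ) * ((P.L : ℂ) ^ (i.1.1 : ℕ)))⁻¹ : ℂ)

end Summit.QuantumFields.YangMills.Theorems.Prop8Chart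

end
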